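import Literature.MathematicalPhysics.QuantumFieldTheory.Balaban1983to89.Node00.CarriersB7
import Literature.MathematicalPhysics.QuantumFieldTheory.Balaban1983to89.B7Prop2SpecialUnitary

/-!
# NODE 00 (YM-PLAN Track A) — the located item «gauge group of the [Balaban1985Averaging] group of record»: the leaf `b7`
# (`B7.Concl` = Props. 1–10 AS TYPED) at ANY gauge group closed under the average (42), and at the paper's `G = SU(N) ⊂ M_N(ℂ)`, `N ≤ 12`

NODE 00 CELL MODULE (seat `pub-ymgap-node00-def` g27, 2026-08-25; director-ym LINE №2 (3) ∕ pub-ymgap lead R413 (B): «FIRST MISSING LEMMA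
at SU(N)?» for the DAG node N04).  Theorems only; count-neutral; nothing of the B7 group OF RECORD is changed — that group is
`Node00.withB7OfRecord X d L 𝔸` with `G = U(𝔸)` (ruling Q-N00-2; `Node00.b7_withB7OfRecord`, `Node00.b7_main_of_isWorldOfRecord₂`), and N04
at the Stage-2 worlds of record is the tree theorem `Node00.b7_main_of_isWorldOfRecord₂` (module `Node00.Carriers2`).  THIS module records,
by kernel theorems, what the tree gives if the gauge group of the [Balaban1985Averaging] carriers is read as a PROPER subgroup `G` of the
units — print p. 18: «values in a Lie subgroup `G` of a unitary group `U(N)`» — in particular `G = SU(N)`: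

* `b7Concl_of_avgClosed` — `B7.Concl` (all ten printed propositions, the printed constants `c₂ = min{1/(3C₀), ½c₂′}`, `C₀ = 14464(d+1)²(d+4)²`,
  `c₂′ = 1/(512(d+1)(d+4)L²)`) for the lineage's concrete `ℤᵈ` carriers with the `k`-fold averages (43) and the `k`-fold expansion data read
  at ANY subgroup `G ≤ 𝔸ˣ` closed under the one-step average (42) at radius `¼` (`B7Prop2Explicit.AvgClosed d L G`); every `d`, every `L ≥ 2`,
  every non-trivial C⋆-algebra `𝔸`.  The assembly is `B7ConclConcrete.concl_concrete` with its `U(𝔸)`-closure witness replaced by `hG`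
  (Props. 1, 3, 8, 9, 10 do not read `G`; Props. 2, 4, 5, 6, 7 read it only through `AvgClosed`).
* `avgClosed_specialUnitary` — `SU(N)`, `N ≤ 12`, IS closed at radius `¼`: the b07 lineage's `B7Prop2SpecialUnitary.avgClosedAt_specialUnitary`
  (closure at every radius `t ≤ ¼` with `N·t < π`, from `det e^X = e^{Tr X}` and `Tr log W = 0` on `SU(N)` near `1`) at `t = ¼`, `N/4 ≤ 3 < π`.
* `b7Concl_specialUnitary` — hence `B7.Concl` for `SU(N)`-valued configurations with `SU(N)`-valued averages, `𝔸 = M_N(ℂ)` with the operator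
  norm (19), `1 ≤ N ≤ 12` (so `SU(2)`, `SU(3)`), with the PRINTED `N`-independent constants.

LOCATED FACTS FOR `N ≥ 13` (tree, by name; not re-proved here): Prop. 2 alone holds for every `N` with `c₂′(d, L, SU(N)) = c2SU d L N`, which
equals the printed `c₂′(d, L)` for `N ≤ 32` (`B7Prop2SpecialUnitary.prop2Printed_specialUnitaryGroup`, `c2SU_eq_c2'`), through the radius
`t_N = min{¼, 1/N}`; Props. 4–7 of the lineage (`B7ConclKExp.prop4Printed_K` … `prop7Printed_K`) are typed at radius `¼` only (`AvgClosed`), so for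
`13 ≤ N` their radius-`t` (`AvgClosedAt`) generalisation is the first missing lemma; and `AvgClosed 2 2 SU(N)` is REFUTED for `N ≥ 26`
(`B7Prop2SpecialUnitary.not_avgClosed_specialUnitary`: the central element `e^{2πi/N}·1`), so the radius-`¼` assembly below cannot serve those `N`.

HONEST FRAMING.  Kernel bookkeeping over the lit-balaban ∕ b2b lineages' theorems (cited by name); no new estimate.  A definition module
`withB7OfRecordSU` (the SU(N) twin of the B7 group of record) is NOT filed here and would need a ruling (Q-N00-2 fixed `G = U(𝔸)`).  One finite
T⁴ programme; NOT continuum ∕ infinite volume ∕ OS ∕ mass gap ∕ Clay.  WHAT THIS IS NOT: not a statement about the 1987 centred blocks of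
[Balaban1987RG1] (0.3)–(0.4) (row item «F6-TRANSFER»), not about tori or subdomains `Ω` (the carriers are `ℤᵈ`-global, as in the lineage).
-/

noncomputable section

namespace Literature.MathematicalPhysics.QuantumFieldTheory.Balaban1983to89.Node00

open B7Prop1Explicit B7Prop2Explicit B7Prop2SpecialUnitary B7ConclOneStep B7ConclKExp B7ConclGauge B7ConclConcrete

/-! ## §1. The leaf `b7` at any average-closed gauge group -/

/-- **`B7.Concl` (Props. 1–10 of [Balaban1985Averaging] AS TYPED) for the lineage's concrete `ℤᵈ` carriers read at ANY gauge group
`G ≤ 𝔸ˣ` closed under the one-step average (42) at radius `¼`** (`AvgClosed d L G`): one-step averages `concreteOneStepBD 𝔸 L`, `k`-fold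
averages `concreteKStep d 𝔸 G L k` (43), `k`-fold expansion data `concreteKExp 𝔸 G L` ((127), (134)–(135), (156)–(157), (164)), gauge data
`concreteGaugeData 𝔸 L` ∕ `concreteGaugeOneStep 𝔸 L` (Sects. E–F); constants `c₂ = cB d L`, `C₀ = C0 d`, `c₂′ = c2' d L`; every `d`, every
`L ≥ 2`, every non-trivial C⋆-algebra `𝔸`.  `B7ConclConcrete.concl_concrete` is the instance `G = U(𝔸)` (`avgClosed_unitaryUnits`).
[cite: Balaban1985Averaging, Props. 1–2 p.26, Prop. 3 p.36, Prop. 4 pp.38–39, Prop. 5 p.42, Props. 6–7 p.43, Prop. 8 p.45, Prop. 9 p.49, Prop. 10 p.50 (kernel versions of the lit-balaban r04 ∕ b07 lineages, assembled)] -/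
theorem b7Concl_of_avgClosed (d L : ℕ) (hL : 2 ≤ L) (𝔸 : Type) [CStarAlgebra 𝔸] [Nontrivial 𝔸] {G : Subgroup 𝔸ˣ}
    (hG : AvgClosed d L G) :
    B7.Concl (L : ℝ) (cB d L) (C0 d) (c2' d L)
      (concreteOneStepBD 𝔸 (d := d) L)
      (fun k : ℕ => concreteKStep d 𝔸 G L k)
      (concreteKExp 𝔸 G (d := d) L)
      (concreteGaugeData 𝔸 (d := d) L)
      (concreteGaugeOneStep 𝔸 (d := d) L) :=
  have hL1 : 1 ≤ L := le_trans (by norm_num) hL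
  { p1 := prop1Printed_BD L hL1
    p2 := prop2Printed_concrete L hL hG
    p3 := prop3Printed_BD L hL1 (cB_pos d hL1)
    p4 := prop4Printed_K L hL hG
    p5 := prop5Printed_K L hL hG
    p6 := prop6Printed_K L hL hG
    p7 := prop7Printed_K L hL hG
    p8 := prop8Printed_G L hL
    p9 := prop9Printed_G L hL1
    p10 := prop10Printed_G L hL }

/-! ## §2. The paper's `G = SU(N) ⊂ M_N(ℂ)` (operator norm (19)), `N ≤ 12` -/

section SpecialUnitary

open scoped Matrix.Norms.L2Operator

/-- **`SU(N)` is closed under the one-step average (42) at the lineage's radius `¼` when `N ≤ 12`** (`N/4 ≤ 3 < π`): the b07 lineage's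
radius-`t` closure `avgClosedAt_specialUnitary` (`t ≤ ¼`, `N·t < π`) at `t = ¼`.  For `N ≥ 26` this is false (`not_avgClosed_specialUnitary`).
[cite: Balaban1985Averaging, (42)–(43) pp.23–24, p.20 (G-valuedness of the averages; kernel version of the b07 lineage)] -/
theorem avgClosed_specialUnitary {N : ℕ} [NeZero N] (hN : N ≤ 12) (d L : ℕ) :
    AvgClosed d L (specialUnitaryUnits (Fin N)) := by
  have hπ : (Fintype.card (Fin N) : ℝ) * (1 / 4) < Real.pi := by
    have hN' : (N : ℝ) ≤ 12 := by exact_mod_cast hN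
    rw [Fintype.card_fin]
    nlinarith [Real.pi_gt_three]
  exact (avgClosedAt_specialUnitary d L le_rfl hπ).avgClosed le_rfl

/-- **`B7.Concl` (Props. 1–10 AS TYPED) for `SU(N)`-valued configurations with `SU(N)`-valued `k`-fold averages, `𝔸 = M_N(ℂ)` with the
operator norm (19), `1 ≤ N ≤ 12`, every `d`, every `L ≥ 2`, with the PRINTED `N`-independent constants** `c₂ = min{1/(3C₀), ½c₂′}`,
`C₀ = 14464(d+1)²(d+4)²`, `c₂′ = 1/(512(d+1)(d+4)L²)` — covers the physical `SU(2)`, `SU(3)`.  The C⋆-algebra structure of `M_N(ℂ)` is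
Mathlib's scoped `L²`-operator-norm structure, assembled in the statement (the cell's `letI … := {}` device of `B7Prop2Explicit` §6).
[cite: Balaban1985Averaging, Props. 1–10 pp.26–50, setting pp.18–21 (17)–(19) (kernel version; SU(N), N ≤ 12)] -/
theorem b7Concl_specialUnitary (N : ℕ) [NeZero N] (hN : N ≤ 12) (d L : ℕ) (hL : 2 ≤ L) :
    letI : CStarAlgebra (Matrix (Fin N) (Fin N) ℂ) := {}
    B7.Concl (L : ℝ) (cB d L) (C0 d) (c2' d L)
      (concreteOneStepBD (Matrix (Fin N) (Fin N) ℂ) (d := d) L)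
      (fun k : ℕ => concreteKStep d (Matrix (Fin N) (Fin N) ℂ) (specialUnitaryUnits (Fin N)) L k)
      (concreteKExp (Matrix (Fin N) (Fin N) ℂ) (specialUnitaryUnits (Fin N)) (d := d) L)
      (concreteGaugeData (Matrix (Fin N) (Fin N) ℂ) (d := d) L)
      (concreteGaugeOneStep (Matrix (Fin N) (Fin N) ℂ) (d := d) L) := by
  letI : CStarAlgebra (Matrix (Fin N) (Fin N) ℂ) := {}
  exact b7Concl_of_avgClosed d L hL (Matrix (Fin N) (Fin N) ℂ) (avgClosed_specialUnitary hN d L)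

end SpecialUnitary

end Literature.MathematicalPhysics.QuantumFieldTheory.Balaban1983to89.Node00

end
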